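import Mathlib
import Summits.Ventures.HodgeRepro2.T5HodgeStar
import Summits.Ventures.HodgeRepro2.T5KahlerModel
import Summits.Ventures.HodgeRepro2.T5WedgeRank
import Summits.Ventures.HodgeRepro2.T5PrimitiveOneOne
import Summits.Ventures.HodgeRepro2.T5OneCovectorNormalisation

/-!
# The wedge of two 1-covectors in the coframe model, and Theorem 6.32 at `k = 1`

Tier-5 support for sub-step N1 (Hodge-theoretic side, route/T5-N1-hodge-p6.md §H1 (V1, V5),
§H3, §H6).  The four-coefficient model of the complex 1-covectors in the orthonormal coframe
`(dx₁, dy₁, dx₂, dy₂)` is `T5OneCovectorNormalisation.OneCovector`; the six-coefficient model of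
the 2-covectors (in the order `dx₁∧dy₁, dx₁∧dx₂, dx₁∧dy₂, dy₁∧dx₂, dy₁∧dy₂, dx₂∧dy₂`) is
`T5HodgeStar.TwoCovector`.  This file defines the exterior product `wedge1 : Λ¹ × Λ¹ → Λ²` of two
1-covectors in these coordinates and proves:

* the BRIDGE between the two models used by the memo: for `(1,0)`-covectors
  `wedge1 (oneZero a) (oneZero b) = twoZero (wedge10 a b)` — the coefficient `wedge10 a b` of
  `T5WedgeRank` (memo §H6, (ii) ⟺ (iii)) is literally the `dz₁∧dz₂`-coordinate of the
  2-covector `f_a^*e_{a,σ} ∧ f_b^*e_{b,σ}` in the model of `T5HodgeStar`;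
* Voisin's formula `ω = (i/2) Σ_i dz_i ∧ dz̄_i` [Voisin, Hodge Theory I, p0063 ll. 29–35] with
  genuine 1-covectors on the right-hand side (`kahler_eq_wedge1`);
* the Hodge–Riemann form of degree `k = 1` on a surface (`n = 2`),
  `Q₁(α, β) = ω^{n-k} ∧ α ∧ β = ω ∧ α ∧ β` and `H₁(α, β) = i^k Q₁(α, β̄) = i Q₁(α, β̄)`
  [Voisin p0128 ll. 19–23], pointwise in the model, and Theorem 6.32 [p0128 l. 35] at `k = 1`:
  the types `(1,0)` and `(0,1)` are `H₁`-orthogonal, `H₁` is positive definite on the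
  `(1,0)`-covectors and `(−1)^{k(k−1)/2} i^{p−q−k} H₁ = −H₁` is positive definite on the
  `(0,1)`-covectors (every 1-covector is primitive on a surface, so no primitivity hypothesis
  appears).

Everything is a finite computation with complex numbers; the manifold, the integration over `S`
and the harmonic representatives stay prose (memo §H2.2, §H3).
-/

namespace Summit.Ventures.HodgeRepro2.T5OneCovectorWedge

open Complex T5HodgeStar T5KahlerModel T5WedgeRank T5PrimitiveOneOne T5OneCovectorNormalisation

/-- The exterior product `u ∧ v` of two complex 1-covectors `u = Σ u_i f_i`, `v = Σ v_i f_i`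
(`f = (dx₁, dy₁, dx₂, dy₂)`), in the six coordinates
`f₀∧f₁, f₀∧f₂, f₀∧f₃, f₁∧f₂, f₁∧f₃, f₂∧f₃` of `T5HodgeStar.TwoCovector`:
the coefficient of `f_i ∧ f_j` (`i < j`) is `u_i v_j − u_j v_i`. -/
def wedge1 (u v : OneCovector) : TwoCovector :=
  ![u 0 * v 1 - u 1 * v 0, u 0 * v 2 - u 2 * v 0, u 0 * v 3 - u 3 * v 0,
    u 1 * v 2 - u 2 * v 1, u 1 * v 3 - u 3 * v 1, u 2 * v 3 - u 3 * v 2]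

/-- Coefficientwise complex conjugation of a 1-covector (`ū` for `u ∈ Λ¹ ⊗ ℂ`). -/
def conj1 (u : OneCovector) : OneCovector := fun i => (starRingEnd ℂ) (u i)

/-- `u ∧ v = −(v ∧ u)`. -/
theorem wedge1_swap (u v : OneCovector) : wedge1 u v = -wedge1 v u := by
  ext i; fin_cases i <;> simp [wedge1] <;> ring

/-- `u ∧ u = 0`. -/
theorem wedge1_self (u : OneCovector) : wedge1 u u = 0 := by
  ext i; fin_cases i <;> simp [wedge1] <;> ring

/-- Additivity of `∧` in the first variable. -/
theorem wedge1_add_left (u u' v : OneCovector) :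
    wedge1 (u + u') v = wedge1 u v + wedge1 u' v := by
  ext i; fin_cases i <;> simp [wedge1] <;> ring

/-- Additivity of `∧` in the second variable. -/
theorem wedge1_add_right (u v v' : OneCovector) :
    wedge1 u (v + v') = wedge1 u v + wedge1 u v' := by
  ext i; fin_cases i <;> simp [wedge1] <;> ring

/-- Homogeneity of `∧` in the first variable. -/
theorem wedge1_smul_left (c : ℂ) (u v : OneCovector) : wedge1 (c • u) v = c • wedge1 u v := by
  ext i; fin_cases i <;> simp [wedge1] <;> ring

/-- Homogeneity of `∧` in the second variable. -/
theorem wedge1_smul_right (c : ℂ) (u v : OneCovector) : wedge1 u (c • v) = c • wedge1 u v := by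
  ext i; fin_cases i <;> simp [wedge1] <;> ring

/-- `u ∧ v` is conjugated coefficientwise: `conj (u ∧ v) = ū ∧ v̄`. -/
theorem conjC_wedge1 (u v : OneCovector) : conjC (wedge1 u v) = wedge1 (conj1 u) (conj1 v) := by
  ext i; fin_cases i <;> simp [wedge1, conjC, conj1, map_sub, map_mul]

/-- `conj1` is an involution. -/
theorem conj1_conj1 (u : OneCovector) : conj1 (conj1 u) = u := by
  ext i; simp [conj1]

/-- `conj (dz_k) = dz̄_k`. -/
theorem conj1_dz (k : Fin 2) : conj1 (dz k) = dzbar k := by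
  ext i; simp only [conj1, dz, dzbar]; split_ifs <;> simp

/-- `conj (dz̄_k) = dz_k`. -/
theorem conj1_dzbar (k : Fin 2) : conj1 (dzbar k) = dz k := by
  ext i; simp only [conj1, dz, dzbar]; split_ifs <;> simp

/-- The conjugate of a `(1,0)`-covector `a₀ dz₁ + a₁ dz₂` is the `(0,1)`-covector
`ā₀ dz̄₁ + ā₁ dz̄₂`. -/
theorem conj1_oneZero (a : Fin 2 → ℂ) :
    conj1 (oneZero a) = zeroOne (fun k => (starRingEnd ℂ) (a k)) := by
  ext i; simp [conj1, oneZero, zeroOne, dz_zero, dz_one, dzbar_zero, dzbar_one]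
  fin_cases i <;> simp

/-- The conjugate of a `(0,1)`-covector `b₀ dz̄₁ + b₁ dz̄₂` is the `(1,0)`-covector
`b̄₀ dz₁ + b̄₁ dz₂`. -/
theorem conj1_zeroOne (b : Fin 2 → ℂ) :
    conj1 (zeroOne b) = oneZero (fun k => (starRingEnd ℂ) (b k)) := by
  ext i; simp [conj1, oneZero, zeroOne, dz_zero, dz_one, dzbar_zero, dzbar_one]
  fin_cases i <;> simp

/-! ### The bridge between the 1-covector model and the 2-covector model -/

/-- `dz₁ ∧ dz₂` computed from the 1-covectors is the `dz12` of `T5HodgeStar`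
(`= (0, 1, i, i, −1, 0)`). -/
theorem wedge1_dz_zero_dz_one : wedge1 (dz 0) (dz 1) = dz12 := by
  ext i; fin_cases i <;> simp [wedge1, dz_zero, dz_one, dz12]

/-- `dz₁ ∧ dz̄₁ = T5KahlerModel.dz1dzbar1`. -/
theorem wedge1_dz_zero_dzbar_zero : wedge1 (dz 0) (dzbar 0) = dz1dzbar1 := by
  ext i; fin_cases i <;> simp [wedge1, dz_zero, dzbar_zero, dz1dzbar1]
  ring

/-- `dz₁ ∧ dz̄₂ = T5KahlerModel.dz1dzbar2`. -/
theorem wedge1_dz_zero_dzbar_one : wedge1 (dz 0) (dzbar 1) = dz1dzbar2 := by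
  ext i; fin_cases i <;> simp [wedge1, dz_zero, dzbar_one, dz1dzbar2]

/-- `dz₂ ∧ dz̄₁ = T5KahlerModel.dz2dzbar1`. -/
theorem wedge1_dz_one_dzbar_zero : wedge1 (dz 1) (dzbar 0) = dz2dzbar1 := by
  ext i; fin_cases i <;> simp [wedge1, dz_one, dzbar_zero, dz2dzbar1]

/-- `dz₂ ∧ dz̄₂ = T5KahlerModel.dz2dzbar2`. -/
theorem wedge1_dz_one_dzbar_one : wedge1 (dz 1) (dzbar 1) = dz2dzbar2 := by
  ext i; fin_cases i <;> simp [wedge1, dz_one, dzbar_one, dz2dzbar2]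
  ring

/-- **The bridge** (memo §H6, (ii) ⟺ (iii)): the wedge of two `(1,0)`-covectors
`a₀ dz₁ + a₁ dz₂` and `b₀ dz₁ + b₁ dz₂` is the `(2,0)`-covector `(a₀ b₁ − a₁ b₀) dz₁ ∧ dz₂`,
i.e. `T5WedgeRank.wedge10 a b` is its coordinate on `dz12`. -/
theorem wedge1_oneZero_oneZero (a b : Fin 2 → ℂ) :
    wedge1 (oneZero a) (oneZero b) = twoZero (wedge10 a b) := by
  have h10 : wedge1 (dz 1) (dz 0) = -dz12 := by rw [wedge1_swap, wedge1_dz_zero_dz_one]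
  simp only [oneZero, wedge1_add_left, wedge1_add_right, wedge1_smul_left, wedge1_smul_right,
    wedge1_self, wedge1_dz_zero_dz_one, h10, twoZero, wedge10]
  module

/-- The wedge of two `(1,0)`-covectors is non-zero iff they are linearly independent
(memo §H6 (ii) ⟺ (iii), now read in the 2-covector model). -/
theorem wedge1_oneZero_oneZero_ne_zero_iff (a b : Fin 2 → ℂ) :
    wedge1 (oneZero a) (oneZero b) ≠ 0 ↔ LinearIndependent ℂ ![a, b] := by
  rw [wedge1_oneZero_oneZero, ← wedge10_ne_zero_iff]
  constructor
  · intro h hw; exact h (by rw [hw, twoZero, zero_smul])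
  · intro h hw; apply h
    have := congrFun hw 1
    simpa [twoZero, dz12] using this

/-- The wedge of a `(1,0)`-covector and a `(0,1)`-covector is the `(1,1)`-covector with
coefficient matrix `a_i b_j` on `dz_i ∧ dz̄_j`. -/
theorem wedge1_oneZero_zeroOne (a b : Fin 2 → ℂ) :
    wedge1 (oneZero a) (zeroOne b) = oneOne (fun i j => a i * b j) := by
  simp only [oneZero, zeroOne, wedge1_add_left, wedge1_add_right, wedge1_smul_left,
    wedge1_smul_right, wedge1_dz_zero_dzbar_zero, wedge1_dz_zero_dzbar_one,
    wedge1_dz_one_dzbar_zero, wedge1_dz_one_dzbar_one, oneOne]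
  module

/-- `α ∧ β̄` for two `(1,0)`-covectors is the `(1,1)`-covector with matrix `a_i b̄_j`. -/
theorem wedge1_oneZero_conj1_oneZero (a b : Fin 2 → ℂ) :
    wedge1 (oneZero a) (conj1 (oneZero b)) = oneOne (fun i j => a i * (starRingEnd ℂ) (b j)) := by
  rw [conj1_oneZero, wedge1_oneZero_zeroOne]

/-- The wedge of two `(0,1)`-covectors is the conjugate of a `(2,0)`-covector. -/
theorem wedge1_zeroOne_zeroOne (a b : Fin 2 → ℂ) :
    wedge1 (zeroOne a) (zeroOne b) =
      conjC (twoZero (wedge10 (fun k => (starRingEnd ℂ) (a k)) (fun k => (starRingEnd ℂ) (b k)))) := by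
  have h1 : zeroOne a = conj1 (oneZero (fun k => (starRingEnd ℂ) (a k))) := by
    rw [conj1_oneZero]; congr; ext k; simp
  have h2 : zeroOne b = conj1 (oneZero (fun k => (starRingEnd ℂ) (b k))) := by
    rw [conj1_oneZero]; congr; ext k; simp
  rw [h1, h2, ← conjC_wedge1, wedge1_oneZero_oneZero]

/-- Voisin's formula for the Kähler form of the standard hermitian metric,
`ω = (i/2) Σ_i dz_i ∧ dz̄_i` [Voisin p0063 ll. 29–35], with the wedges computed from the
1-covectors `dz_i`, `dz̄_i` of `T5OneCovectorNormalisation`. -/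
theorem kahler_eq_wedge1 :
    kahler = (I / 2) • (wedge1 (dz 0) (dzbar 0) + wedge1 (dz 1) (dzbar 1)) := by
  rw [wedge1_dz_zero_dzbar_zero, wedge1_dz_one_dzbar_one, kahler_eq]

/-! ### The Hodge–Riemann form of degree one on a surface -/

/-- The Vol-coefficient of `ω ∧ γ` is additive in `γ`. -/
theorem wedge_kahler_add (γ δ : TwoCovector) :
    wedge kahler (γ + δ) = wedge kahler γ + wedge kahler δ := by
  simp [wedge]; ring

/-- The Vol-coefficient of `ω ∧ γ` is homogeneous in `γ`. -/
theorem wedge_kahler_smul (c : ℂ) (γ : TwoCovector) : wedge kahler (c • γ) = c * wedge kahler γ := by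
  simp [wedge]; ring

/-- `ω ∧ ᾱ = 0` for a `(2,0)`-covector `α` (so `ω ∧ Λ^{0,2} = 0`, the conjugate of
`T5KahlerModel.wedge_kahler_twoZero`). -/
theorem wedge_kahler_conjC_twoZero (a : ℂ) : wedge kahler (conjC (twoZero a)) = 0 := by
  simp [wedge, kahler, conjC, twoZero, dz12]

/-- The Hodge–Riemann bilinear form in degree `k = 1` on a surface (`n = 2`), pointwise:
`Q₁(α, β) = ω^{n−k} ∧ α ∧ β = ω ∧ α ∧ β`, as a coefficient of the volume form
[Voisin p0128 l. 19: `Q(α, β) = ∫_X ω^{n−k} ∧ α ∧ β`]. -/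
def Q1 (α β : OneCovector) : ℂ := wedge kahler (wedge1 α β)

/-- The hermitian form `H₁(α, β) = i^k Q₁(α, β̄)` with `k = 1` [Voisin p0128 l. 23]. -/
def H1 (α β : OneCovector) : ℂ := I * Q1 α (conj1 β)

/-- `Q₁` is antisymmetric (as it must be for `k` odd). -/
theorem Q1_swap (α β : OneCovector) : Q1 α β = -Q1 β α := by
  simp only [Q1, wedge1_swap α β]
  have := wedge_kahler_smul (-1) (wedge1 β α)
  simpa [neg_one_smul] using this

/-- `Q₁` on two `(1,0)`-covectors vanishes (`ω ∧ Λ^{2,0} = Λ^{3,1} = 0` on a surface). -/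
theorem Q1_oneZero_oneZero (a b : Fin 2 → ℂ) : Q1 (oneZero a) (oneZero b) = 0 := by
  simp only [Q1, wedge1_oneZero_oneZero, wedge_kahler_twoZero]

/-- `Q₁` on two `(0,1)`-covectors vanishes (`ω ∧ Λ^{0,2} = Λ^{1,3} = 0`). -/
theorem Q1_zeroOne_zeroOne (a b : Fin 2 → ℂ) : Q1 (zeroOne a) (zeroOne b) = 0 := by
  simp only [Q1, wedge1_zeroOne_zeroOne, wedge_kahler_conjC_twoZero]

/-- `Q₁(α, β̄) = −2i Σ_k a_k b̄_k` for `(1,0)`-covectors `α = Σ a_k dz_k`, `β = Σ b_k dz_k`: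
the Lefschetz operator on the `(1,1)`-covector `α ∧ β̄` (`T5PrimitiveOneOne.wedge_kahler_oneOne`). -/
theorem Q1_oneZero_conj1_oneZero (a b : Fin 2 → ℂ) :
    Q1 (oneZero a) (conj1 (oneZero b)) = -2 * I * h10 a b := by
  simp only [Q1, wedge1_oneZero_conj1_oneZero, wedge_kahler_oneOne, trace, h10, Fin.sum_univ_two]

/-- `H₁(α, β) = 2 Σ_k a_k b̄_k = 2 h^{1,0}(a, b)` on the `(1,0)`-covectors. -/
theorem H1_oneZero_oneZero (a b : Fin 2 → ℂ) : H1 (oneZero a) (oneZero b) = 2 * h10 a b := by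
  simp only [H1, Q1_oneZero_conj1_oneZero]; ring_nf; simp [I_sq]

/-- `H₁(α, β) = −2 Σ_k a_k b̄_k = −2 h^{0,1}(a, b)` on the `(0,1)`-covectors. -/
theorem H1_zeroOne_zeroOne (a b : Fin 2 → ℂ) : H1 (zeroOne a) (zeroOne b) = -2 * h01 a b := by
  have h : wedge1 (zeroOne a) (conj1 (zeroOne b)) =
      -oneOne (fun i j => (starRingEnd ℂ) (b i) * a j) := by
    rw [conj1_zeroOne, wedge1_swap, wedge1_oneZero_zeroOne]
  have hw : wedge kahler (-oneOne (fun i j => (starRingEnd ℂ) (b i) * a j)) =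
      -wedge kahler (oneOne (fun i j => (starRingEnd ℂ) (b i) * a j)) := by
    have := wedge_kahler_smul (-1) (oneOne (fun i j => (starRingEnd ℂ) (b i) * a j))
    simpa [neg_one_smul] using this
  simp only [H1, Q1, h, hw, wedge_kahler_oneOne, trace, h01, Fin.sum_univ_two]
  ring_nf; simp [I_sq]; ring

/-- **Orthogonality of the types** (Theorem 6.32, first clause, at `k = 1`):
`H₁(Λ^{1,0}, Λ^{0,1}) = 0`. -/
theorem H1_oneZero_zeroOne (a b : Fin 2 → ℂ) : H1 (oneZero a) (zeroOne b) = 0 := by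
  simp only [H1, conj1_zeroOne, Q1_oneZero_oneZero, mul_zero]

/-- `H₁(Λ^{0,1}, Λ^{1,0}) = 0`. -/
theorem H1_zeroOne_oneZero (a b : Fin 2 → ℂ) : H1 (zeroOne a) (oneZero b) = 0 := by
  simp only [H1, conj1_oneZero, Q1_zeroOne_zeroOne, mul_zero]

/-- `H₁` is additive in its first variable. -/
theorem H1_add_left (α α' β : OneCovector) : H1 (α + α') β = H1 α β + H1 α' β := by
  simp only [H1, Q1, wedge1_add_left, wedge_kahler_add]; ring

/-- `H₁` is additive in its second variable. -/
theorem H1_add_right (α β β' : OneCovector) : H1 α (β + β') = H1 α β + H1 α β' := by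
  have : conj1 (β + β') = conj1 β + conj1 β' := by ext i; simp [conj1]
  simp only [H1, Q1, this, wedge1_add_right, wedge_kahler_add]; ring

/-- **Theorem 6.32, first clause, at `k = 1`** (the direct-sum decomposition is
`H₁`-orthogonal): for `α = α^{1,0} + α^{0,1}` and `β = β^{1,0} + β^{0,1}`,
`H₁(α, β) = H₁(α^{1,0}, β^{1,0}) + H₁(α^{0,1}, β^{0,1}) = 2 h^{1,0}(a, a') − 2 h^{0,1}(b, b')`. -/
theorem H1_types (a b a' b' : Fin 2 → ℂ) :
    H1 (oneZero a + zeroOne b) (oneZero a' + zeroOne b') = 2 * h10 a a' - 2 * h01 b b' := by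
  rw [H1_add_left, H1_add_right, H1_add_right, H1_oneZero_oneZero, H1_oneZero_zeroOne,
    H1_zeroOne_oneZero, H1_zeroOne_zeroOne]
  ring

/-- `h^{1,0}(a, a) = Σ_k |a_k|²` is real and non-negative. -/
theorem h10_self (a : Fin 2 → ℂ) : h10 a a = ((∑ k, Complex.normSq (a k) : ℝ) : ℂ) := by
  simp [h10, Complex.mul_conj]

/-- `h^{1,0}(a, a) = 0` iff `a = 0`. -/
theorem h10_self_eq_zero_iff (a : Fin 2 → ℂ) : h10 a a = 0 ↔ a = 0 := by
  rw [h10_self]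
  constructor
  · intro h
    have h' : (∑ k, Complex.normSq (a k) : ℝ) = 0 := by exact_mod_cast h
    rw [Finset.sum_eq_zero_iff_of_nonneg (fun k _ => Complex.normSq_nonneg (a k))] at h'
    ext k; simpa using h' k (Finset.mem_univ k)
  · rintro rfl; simp

/-- **Theorem 6.32, second clause, at `(p, q) = (1, 0)`**, pointwise: `H₁(α, α) = 2 Σ|a_k|² > 0`
for a non-zero `(1,0)`-covector `α = Σ a_k dz_k` (the sign `(−1)^{k(k−1)/2} i^{p−q−k} = 1`). -/
theorem H1_oneZero_self_pos (a : Fin 2 → ℂ) (ha : a ≠ 0) : 0 < (H1 (oneZero a) (oneZero a)).re := by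
  rw [H1_oneZero_oneZero, h10_self]
  obtain ⟨k, hk⟩ := Function.ne_iff.mp ha
  have : (0 : ℝ) < ∑ k, Complex.normSq (a k) :=
    Finset.sum_pos' (fun k _ => Complex.normSq_nonneg _)
      ⟨k, Finset.mem_univ _, Complex.normSq_pos.mpr hk⟩
  simpa using this

/-- `H₁(α, α) = 0` iff `α = 0` on the `(1,0)`-covectors. -/
theorem H1_oneZero_self_eq_zero_iff (a : Fin 2 → ℂ) : H1 (oneZero a) (oneZero a) = 0 ↔ a = 0 := by
  rw [H1_oneZero_oneZero, mul_eq_zero, h10_self_eq_zero_iff]; simp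

/-- The printed form of Theorem 6.32 at `(p, q, k) = (1, 0, 1)`:
`(−1)^{k(k−1)/2} i^{p−q−k} H₁ = i^{0} H₁ = H₁` is positive definite on `Λ^{1,0}`. -/
theorem thm632_oneZero_pos (a : Fin 2 → ℂ) (ha : a ≠ 0) :
    0 < ((-1) ^ (1 * (1 - 1) / 2) * I ^ ((1 : ℤ) - 0 - 1) * (I ^ 1 * Q1 (oneZero a) (conj1 (oneZero a)))).re := by
  have h := H1_oneZero_self_pos a ha
  simp only [H1] at h
  simpa using h

/-- **Theorem 6.32, second clause, at `(p, q) = (0, 1)`**, pointwise: `−H₁(β, β) = 2 Σ|b_k|² > 0`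
for a non-zero `(0,1)`-covector `β = Σ b_k dz̄_k` (the sign `(−1)^{k(k−1)/2} i^{p−q−k} = i^{−2} = −1`). -/
theorem neg_H1_zeroOne_self_pos (b : Fin 2 → ℂ) (hb : b ≠ 0) :
    0 < (-H1 (zeroOne b) (zeroOne b)).re := by
  rw [H1_zeroOne_zeroOne]
  have : h01 b b = ((∑ k, Complex.normSq (b k) : ℝ) : ℂ) := by simp [h01, Complex.mul_conj]
  rw [this]
  obtain ⟨k, hk⟩ := Function.ne_iff.mp hb
  have hpos : (0 : ℝ) < ∑ k, Complex.normSq (b k) :=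
    Finset.sum_pos' (fun k _ => Complex.normSq_nonneg _)
      ⟨k, Finset.mem_univ _, Complex.normSq_pos.mpr hk⟩
  simpa using hpos

/-- `i^{−2} = −1`. -/
theorem I_zpow_neg_two' : I ^ ((0 : ℤ) - 1 - 1) = -1 := by
  have h : ((0 : ℤ) - 1 - 1) = -2 := by norm_num
  rw [h, zpow_neg, zpow_two, I_mul_I]; norm_num

/-- The printed form of Theorem 6.32 at `(p, q, k) = (0, 1, 1)`:
`(−1)^{k(k−1)/2} i^{p−q−k} H₁ = i^{−2} H₁ = −H₁` is positive definite on `Λ^{0,1}`. -/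
theorem thm632_zeroOne_pos (b : Fin 2 → ℂ) (hb : b ≠ 0) :
    0 < ((-1) ^ (1 * (1 - 1) / 2) * I ^ ((0 : ℤ) - 1 - 1) * (I ^ 1 * Q1 (zeroOne b) (conj1 (zeroOne b)))).re := by
  have h := neg_H1_zeroOne_self_pos b hb
  simp only [H1] at h
  rw [I_zpow_neg_two']
  simpa using h

end Summit.Ventures.HodgeRepro2.T5OneCovectorWedge
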